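import Literature.NumberTheory.Sieve.BombieriFriedlanderIwaniecKuznetsovTransformsBessel
import Literature.Analysis.FunctionSpaces.BesselKConnection
import HarnessLib

/-!
# The `J`-Bessel form of the plus transforms: `φ̃(t) = (2πi/sinh πt) ∫₀^∞ (J_{2it}(x) - J_{-2it}(x)) φ(x) dx/x`

Companion of `Literature.NumberTheory.Sieve.BombieriFriedlanderIwaniecKuznetsovTransforms` (which DEFINES the
Kuznetsov transforms `kuzTransforms` in the absolutely convergent Mehler–Sonine form
`Tpl φ t = 4 ∫_ℝ cos(2tξ) H₊φ(ξ) dξ`, `H₊φ(ξ) = ∫ cos(x cosh ξ) φ(x) dx/x`) and of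
`…KuznetsovTransformsBessel` (the minus transforms are the `K`-Bessel transforms). Here we PROVE, for the plus
sign, that these are the classical transforms of Kuznetsov's formula: for `φ ∈ C¹` with compact support in
`(0, ∞)`,

* `kuzTransforms_Tpl_eq_besselJ`: `Tpl φ t = (2πi/sinh(πt)) ∫₀^∞ (J_{2it}(x) - J_{-2it}(x)) φ(x) dx/x` (real `t ≠ 0`) —
  `φ̃(t)`/`φ̂(t)` of [DeshouillersIwaniec1982, (1.17)–(1.19)], [Drappeau2017, (4.12)], [Iwaniec2002, (9.13)];
* `kuzTransforms_TplX_eq_besselJ`: `TplX φ y = (2π/sin(πy)) ∫₀^∞ (J_{-2y}(x) - J_{2y}(x)) φ(x) dx/x` (`0 < |y| < 1/2`) —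
  the value `φ̃(iy)` at an exceptional spectral parameter;
* `four_mul_integral_cosh_mul_Hp`: the general-order identity behind both,
  `4∫_ℝ cosh(νξ) H₊φ(ξ) dξ = 4(π cos(πν/2)/sin πν) ∫₀^∞ (J_{-ν} - J_ν)(x) φ(x) dx/x` for `|Re ν| < 1`, `ν ∉ ℤ`,

with the complex-order Bessel function `besselJC` of `Literature.Analysis.FunctionSpaces.BesselJIComplexOrder`
(Iwaniec's (B.28)). This is the integrated form of the Mehler–Sonine formula
`∫₀^∞ cos(x cosh ξ) cosh(νξ) dξ = -(π/4)(J_ν(x) - J_{-ν}(x))/sin(νπ/2)` ([Watson1944, §6.21]; Iwaniec's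
`B_ν = (2 sin(πν/2))⁻¹(J_{-ν} - J_ν)`, (B.47)), whose left side is only conditionally convergent; the proof below
never uses conditionally convergent integrals.

## The argument (boundary values of `K_ν` on the imaginary axis)

For `ρ = φ/x` (`Kuz.IsPosTest`) and `ε > 0`, Fubini gives the absolutely convergent identity
`∫ ρ(x)(K_ν(ε+ix) + K_ν(ε-ix)) dx = 2∫₀^∞ e^{-ε cosh u} cosh(νu) P_ρ(cosh u) du` (`integral_mul_besselK_add`;
`K_ν(z) = ∫₀^∞ e^{-z cosh u} cosh(νu) du`, `P_ρ(s) = ∫ cos(sx)ρ(x) dx = (𝓛ρ(is) + 𝓛ρ(-is))/2`). As `ε → 0⁺`: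
the right side tends to `2∫₀^∞ cosh(νu) P_ρ(cosh u) du` for `|Re ν| < 1` (dominated convergence with
`‖P_ρ(cosh u)‖ ≤ ‖ρ'‖₁/cosh u`, `tendsto_integral_exp_cosh_Pc`); on the left, by the connection formula
`K_ν(z) = (π/2)(I_{-ν}(z) - I_ν(z))/sin(πν)` on `Re z > 0` (`besselK_eq_besselIC_of_re_pos`, `BesselKConnection.lean`),
the continuity of `I_{±ν}` at `±ix` (points of the slit plane) and `I_μ(ix) + I_μ(-ix) = 2cos(πμ/2) J_μ(x)`
(`besselIC_I_mul`), the integrand tends boundedly to `ρ(x)(π cos(πν/2)/sin πν)(J_{-ν}(x) - J_ν(x))`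
(`tendsto_integral_mul_besselK_add`). Take `ν = 2it` (`cosh(2itu) = cos 2tu`, `cos(iπt) = cosh πt`,
`sin(2πit) = i sinh 2πt`) and `ν = 2y`.

## References
* [DeshouillersIwaniec1982] J.-M. Deshouillers, H. Iwaniec, *Kloosterman sums and Fourier coefficients of cusp
  forms*, Invent. Math. 70 (1982), (1.17)–(1.19), §7.
* [Drappeau2017] S. Drappeau, Proc. LMS 114 (2017), §4.1.3 (4.12).
* [Iwaniec2002] H. Iwaniec, *Spectral Methods of Automorphic Forms*, GSM 53, (9.13) and Appendix B (B.28), (B.34),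
  (B.47) (held copy `book:iwaniec2002-spectral-methods-automorphic-forms`, p0144, p0146).
* [Watson1944] G. N. Watson, *A Treatise on the Theory of Bessel Functions*, §6.21 (Mehler–Sonine), §3.7 (2).

Literature: `Kuz.Lap`, `Kuz.Pc`, `Kuz.IsPosTest` (+ `norm_Lap_le(_div)`, `Lap_I_add_Lap_neg_I`, `differentiable_Lap`),
`isPosTest_div`, `Pk_zero_eq_Pc`, `exists_Icc_of_admissible` (`…KuznetsovTransformsBessel`); `kuzTransforms`,
`Kuz.IsTest.Hp` (`…KuznetsovTransforms`); `besselK`, `norm_cosh_mul_le` (`BesselK.lean`); `besselJC`, `besselIC`,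
`besselIC_I_mul`, `besselIC_neg_I_mul` (`BesselJIComplexOrder.lean`); `besselK_eq_besselIC_of_re_pos`,
`differentiableOn_besselIC`, `differentiableOn_besselK_right` (`BesselKConnection.lean`);
`integrable_polyaKernel_mul_exp`, `polyaKernel_zero` (`PolyaBesselKernel.lean`).
Mathlib: `integral_integral_swap`, `Integrable.mul_prod`, `tendsto_integral_filter_of_dominated_convergence`,
`IsCompact.exists_bound_of_continuousOn`, `exp_neg_integrableOn_Ioi`, `intervalIntegral.integral_Iic_add_Ioi`.
-/

noncomputable section

open MeasureTheory Set Filter Real Complex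
open scoped Topology

namespace Literature.NumberTheory.Sieve.BFI.L1.Kuz

open Literature.Analysis.FunctionSpaces Literature.Analysis.Complex.Polya1926

namespace IsPosTest

variable {ρ : ℝ → ℂ} {a b : ℝ} (h : IsPosTest ρ a b)
include h

/-- For `ε > 0` and `Re c ≥ 0`: `x ↦ ρ(x) K_ν(ε + cx)` is integrable and
`∫ ρ(x) K_ν(ε + cx) dx = ∫₀^∞ e^{-ε cosh u} cosh(νu) 𝓛ρ(c cosh u) du`
(Fubini: the double integral converges absolutely thanks to the factor `e^{-ε cosh u}`). [folklore] -/
theorem integral_mul_besselK_eps (ν c : ℂ) (hc : 0 ≤ c.re) {ε : ℝ} (hε : 0 < ε) :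
    Integrable (fun x : ℝ => ρ x * besselK ν ((ε : ℂ) + c * x)) ∧
    ∫ x : ℝ, ρ x * besselK ν ((ε : ℂ) + c * x) =
      ∫ u in Ioi (0 : ℝ), (Real.exp (-(ε * Real.cosh u)) : ℂ) * Complex.cosh (ν * u) * Lap ρ (c * (Real.cosh u : ℂ)) := by
  -- the integrand on `ℝ × (0, ∞)`
  set F : ℝ → ℝ → ℂ := fun x u =>
    ρ x * (Complex.exp (-((ε : ℂ) + c * x) * (Real.cosh u : ℂ)) * Complex.cosh (ν * u)) with hF
  have hFeq : ∀ x u, F x u = ((Real.exp (-(ε * Real.cosh u)) : ℂ) * Complex.cosh (ν * u)) *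
      (Complex.exp (-(x : ℂ) * (c * (Real.cosh u : ℂ))) * ρ x) := by
    intro x u
    simp only [hF]
    rw [show -((ε : ℂ) + c * x) * (Real.cosh u : ℂ) = ((-(ε * Real.cosh u) : ℝ) : ℂ) + (-(x : ℂ) * (c * (Real.cosh u : ℂ))) by
      push_cast; ring, Complex.exp_add, Complex.ofReal_exp]
    ring
  -- integrability on the product
  have hg : Integrable (fun u : ℝ => Real.exp (-(ε * Real.cosh u)) * Real.exp (|ν.re| * |u|))
      ((volume : Measure ℝ).restrict (Ioi (0 : ℝ))) := by
    have h1 := (integrable_polyaKernel_mul_exp hε 0 |ν.re|).integrableOn (s := Ioi (0 : ℝ))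
    have h2 : IntegrableOn (fun u : ℝ => Real.exp (-(ε * Real.cosh u)) * Real.exp (|ν.re| * |u|)) (Ioi 0) :=
      h1.congr_fun (fun u _ => by simp only [polyaKernel_zero]) measurableSet_Ioi
    exact h2
  have hint : Integrable (Function.uncurry F) ((volume : Measure ℝ).prod (volume.restrict (Ioi (0 : ℝ)))) := by
    have hprod := h.integrable.norm.mul_prod hg
    refine hprod.mono' ?_ (ae_of_all _ fun p => ?_)
    · have hcF : Continuous (Function.uncurry F) := by
        have hρc : Continuous ρ := h.smooth.continuous
        simp only [hF, Function.uncurry_def]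
        fun_prop
      exact hcF.aestronglyMeasurable
    · rcases p with ⟨x, u⟩
      simp only [Function.uncurry_apply_pair, hF]
      rw [norm_mul, norm_mul, Complex.norm_exp]
      by_cases hx : ρ x = 0
      · simp [hx]
      · have hxa : x ∈ Set.Icc a b := h.supp x hx
        have hx0 : 0 ≤ x := h.pos.le.trans hxa.1
        have hre : (-((ε : ℂ) + c * x) * (Real.cosh u : ℂ)).re = -((ε + c.re * x) * Real.cosh u) := by
          simp [Complex.mul_re]; ring
        rw [hre]
        have h1 : Real.exp (-((ε + c.re * x) * Real.cosh u)) ≤ Real.exp (-(ε * Real.cosh u)) := by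
          rw [Real.exp_le_exp]
          have : 0 ≤ c.re * x * Real.cosh u := by
            have := Real.cosh_pos u; positivity
          nlinarith
        have h2 := norm_cosh_mul_le ν u
        have h0 : 0 ≤ ‖ρ x‖ := norm_nonneg _
        calc ‖ρ x‖ * (Real.exp (-((ε + c.re * x) * Real.cosh u)) * ‖Complex.cosh (ν * u)‖)
            ≤ ‖ρ x‖ * (Real.exp (-(ε * Real.cosh u)) * Real.exp (|ν.re| * |u|)) := by
              gcongr
          _ = _ := by ring
  -- the left side as an iterated integral
  have hL : ∀ x : ℝ, ρ x * besselK ν ((ε : ℂ) + c * x) = ∫ u in Ioi (0 : ℝ), F x u := by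
    intro x
    rw [besselK_def, ← integral_const_mul]
  refine ⟨?_, ?_⟩
  · exact hint.integral_prod_left.congr (ae_of_all _ fun x => (hL x).symm)
  · calc (∫ x : ℝ, ρ x * besselK ν ((ε : ℂ) + c * x)) = ∫ x : ℝ, ∫ u in Ioi (0 : ℝ), F x u :=
          integral_congr_ae (ae_of_all _ fun x => hL x)
      _ = ∫ u in Ioi (0 : ℝ), ∫ x : ℝ, F x u := integral_integral_swap hint
      _ = _ := by
          refine integral_congr_ae (ae_of_all _ fun u => ?_)
          simp only [hFeq, Lap]
          rw [integral_const_mul]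

/-- `u ↦ 𝓛ρ(c cosh u)` is continuous. [folklore] -/
theorem continuous_Lap_mul_cosh (c : ℂ) : Continuous fun u : ℝ => Lap ρ (c * (Real.cosh u : ℂ)) :=
  h.differentiable_Lap.continuous.comp (by fun_prop)

/-- `u ↦ e^{-ε cosh u} cosh(νu) 𝓛ρ(c cosh u)` is integrable on `(0, ∞)` for `ε > 0`, `Re c ≥ 0`. [folklore] -/
theorem integrableOn_exp_cosh_Lap (ν c : ℂ) (hc : 0 ≤ c.re) {ε : ℝ} (hε : 0 < ε) :
    IntegrableOn (fun u : ℝ => (Real.exp (-(ε * Real.cosh u)) : ℂ) * Complex.cosh (ν * u) * Lap ρ (c * (Real.cosh u : ℂ)))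
      (Ioi 0) := by
  have h1 := (integrable_polyaKernel_mul_exp hε 0 |ν.re|).integrableOn (s := Ioi (0 : ℝ))
  have h2 : IntegrableOn (fun u : ℝ => Real.exp (-(ε * Real.cosh u)) * Real.exp (|ν.re| * |u|) * ∫ x, ‖ρ x‖) (Ioi 0) :=
    (h1.congr_fun (fun u _ => by simp only [polyaKernel_zero]) measurableSet_Ioi).mul_const _
  refine h2.mono' ?_ (ae_of_all _ fun u => ?_)
  · have : Continuous fun u : ℝ => (Real.exp (-(ε * Real.cosh u)) : ℂ) * Complex.cosh (ν * u) * Lap ρ (c * (Real.cosh u : ℂ)) :=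
      (by fun_prop : Continuous fun u : ℝ => (Real.exp (-(ε * Real.cosh u)) : ℂ) * Complex.cosh (ν * u)).mul
        (h.continuous_Lap_mul_cosh c)
    exact this.aestronglyMeasurable
  · rw [norm_mul, norm_mul, Complex.norm_real, Real.norm_eq_abs, abs_of_pos (Real.exp_pos _)]
    have hw : 0 ≤ (c * (Real.cosh u : ℂ)).re := by
      simp [Complex.mul_re]; have := Real.cosh_pos u; positivity
    have h3 := h.norm_Lap_le hw
    have h4 := norm_cosh_mul_le ν u
    have h0 : 0 ≤ ∫ x, ‖ρ x‖ := integral_nonneg fun x => norm_nonneg _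
    gcongr

/-- **The regularised bridge** (`ε > 0`, any complex `ν`):
`∫ ρ(x) (K_ν(ε + ix) + K_ν(ε - ix)) dx = 2 ∫₀^∞ e^{-ε cosh u} cosh(νu) P_ρ(cosh u) du`. [folklore] -/
theorem integral_mul_besselK_add (ν : ℂ) {ε : ℝ} (hε : 0 < ε) :
    ∫ x : ℝ, ρ x * (besselK ν ((ε : ℂ) + I * x) + besselK ν ((ε : ℂ) + -I * x)) =
      2 * ∫ u in Ioi (0 : ℝ), (Real.exp (-(ε * Real.cosh u)) : ℂ) * Complex.cosh (ν * u) * Pc ρ (Real.cosh u) := by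
  obtain ⟨i1, e1⟩ := h.integral_mul_besselK_eps ν I (by simp) hε
  obtain ⟨i2, e2⟩ := h.integral_mul_besselK_eps ν (-I) (by simp) hε
  have j1 := h.integrableOn_exp_cosh_Lap ν I (by simp) hε
  have j2 := h.integrableOn_exp_cosh_Lap ν (-I) (by simp) hε
  calc (∫ x : ℝ, ρ x * (besselK ν ((ε : ℂ) + I * x) + besselK ν ((ε : ℂ) + -I * x)))
      = (∫ x : ℝ, ρ x * besselK ν ((ε : ℂ) + I * x)) + ∫ x : ℝ, ρ x * besselK ν ((ε : ℂ) + -I * x) := by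
        rw [← integral_add i1 i2]
        refine integral_congr_ae (ae_of_all _ fun x => ?_)
        ring
    _ = ∫ u in Ioi (0 : ℝ), ((Real.exp (-(ε * Real.cosh u)) : ℂ) * Complex.cosh (ν * u) * Lap ρ (I * (Real.cosh u : ℂ)) +
          (Real.exp (-(ε * Real.cosh u)) : ℂ) * Complex.cosh (ν * u) * Lap ρ (-I * (Real.cosh u : ℂ))) := by
        rw [e1, e2, integral_add j1 j2]
    _ = ∫ u in Ioi (0 : ℝ), 2 * ((Real.exp (-(ε * Real.cosh u)) : ℂ) * Complex.cosh (ν * u) * Pc ρ (Real.cosh u)) := by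
        refine integral_congr_ae (ae_of_all _ fun u => ?_)
        have := h.Lap_I_add_Lap_neg_I (Real.cosh u)
        linear_combination ((Real.exp (-(ε * Real.cosh u)) : ℂ) * Complex.cosh (ν * u)) * this
    _ = _ := integral_const_mul _ _

/-! ### The limit `ε → 0⁺` on the `u`-side -/

/-- `‖P_ρ(cosh u)‖ ≤ ‖ρ'‖₁ / cosh u`. [folklore] -/
theorem norm_Pc_cosh_le (u : ℝ) : ‖Pc ρ (Real.cosh u)‖ ≤ (∫ x, ‖deriv ρ x‖) / Real.cosh u := by
  have e : Pc ρ (Real.cosh u) = (Lap ρ (I * Real.cosh u) + Lap ρ (-I * Real.cosh u)) / 2 := by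
    rw [h.Lap_I_add_Lap_neg_I]; ring
  have hch := Real.cosh_pos u
  have hc0 : (Real.cosh u : ℂ) ≠ 0 := by exact_mod_cast hch.ne'
  have n1 : ‖I * (Real.cosh u : ℂ)‖ = Real.cosh u := by
    rw [norm_mul, Complex.norm_I, one_mul, Complex.norm_real, Real.norm_eq_abs, abs_of_pos hch]
  have n2 : ‖-I * (Real.cosh u : ℂ)‖ = Real.cosh u := by rw [neg_mul, norm_neg, n1]
  have h1 := h.norm_Lap_le_div (w := I * Real.cosh u) (by simp) (mul_ne_zero I_ne_zero hc0)
  have h2 := h.norm_Lap_le_div (w := -I * Real.cosh u) (by simp) (mul_ne_zero (neg_ne_zero.2 I_ne_zero) hc0)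
  rw [n1] at h1
  rw [n2] at h2
  rw [e, norm_div, Complex.norm_two]
  calc ‖Lap ρ (I * Real.cosh u) + Lap ρ (-I * Real.cosh u)‖ / 2
      ≤ (‖Lap ρ (I * Real.cosh u)‖ + ‖Lap ρ (-I * Real.cosh u)‖) / 2 := by gcongr; exact norm_add_le _ _
    _ ≤ ((∫ x, ‖deriv ρ x‖) / Real.cosh u + (∫ x, ‖deriv ρ x‖) / Real.cosh u) / 2 := by gcongr
    _ = _ := by ring

/-- `u ↦ P_ρ(cosh u)` is continuous. [folklore] -/
theorem continuous_Pc_cosh : Continuous fun u : ℝ => Pc ρ (Real.cosh u) := by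
  have e : (fun u : ℝ => Pc ρ (Real.cosh u)) = fun u => (Lap ρ (I * Real.cosh u) + Lap ρ (-I * Real.cosh u)) / 2 := by
    funext u; rw [h.Lap_I_add_Lap_neg_I]; ring
  rw [e]
  have hL := h.differentiable_Lap.continuous
  exact ((hL.comp (by fun_prop)).add (hL.comp (by fun_prop))).div_const _

omit h in
/-- `e^u ≤ 2 cosh u`, i.e. `e^{αu}/cosh u ≤ 2 e^{-(1-α)u}`. [folklore] -/
theorem exp_mul_div_cosh_le (α u : ℝ) : Real.exp (α * u) / Real.cosh u ≤ 2 * Real.exp (-(1 - α) * u) := by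
  have hch := Real.cosh_pos u
  rw [div_le_iff₀ hch, Real.cosh_eq]
  have e1 : Real.exp (α * u) = Real.exp (-(1 - α) * u) * Real.exp u := by rw [← Real.exp_add]; ring_nf
  rw [e1]
  have := Real.exp_pos (-(1 - α) * u)
  have := Real.exp_pos (-u)
  nlinarith

omit h in
/-- The dominating function `e^{|Re ν| u} ‖ρ'‖₁/cosh u` is integrable on `(0, ∞)` when `|Re ν| < 1`. [folklore] -/
theorem integrableOn_bound (ν : ℂ) (hν : |ν.re| < 1) :
    IntegrableOn (fun u : ℝ => Real.exp (|ν.re| * |u|) * ((∫ x, ‖deriv ρ x‖) / Real.cosh u)) (Ioi 0) := by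
  set C : ℝ := ∫ x, ‖deriv ρ x‖ with hC
  have hC0 : 0 ≤ C := integral_nonneg fun x => norm_nonneg _
  have hb : 0 < 1 - |ν.re| := by linarith
  have hi := ((exp_neg_integrableOn_Ioi 0 hb).const_mul (2 * C))
  have hcont : Continuous fun u : ℝ => Real.exp (|ν.re| * |u|) * (C / Real.cosh u) :=
    (by fun_prop : Continuous fun u : ℝ => Real.exp (|ν.re| * |u|)).mul
      (continuous_const.div Real.continuous_cosh fun u => (Real.cosh_pos u).ne')
  refine hi.mono' hcont.aestronglyMeasurable ?_
  refine (ae_restrict_iff' measurableSet_Ioi).2 (ae_of_all _ fun u hu => ?_)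
  have hu : (0 : ℝ) < u := hu
  rw [abs_of_pos hu, Real.norm_eq_abs, abs_of_nonneg (by have := Real.cosh_pos u; positivity)]
  have := exp_mul_div_cosh_le |ν.re| u
  calc Real.exp (|ν.re| * u) * (C / Real.cosh u) = C * (Real.exp (|ν.re| * u) / Real.cosh u) := by ring
    _ ≤ C * (2 * Real.exp (-(1 - |ν.re|) * u)) := by gcongr
    _ = 2 * C * Real.exp (-(1 - |ν.re|) * u) := by ring

/-- **The limit on the `u`-side**: as `ε → 0⁺`,
`∫₀^∞ e^{-ε cosh u} cosh(νu) P_ρ(cosh u) du → ∫₀^∞ cosh(νu) P_ρ(cosh u) du` for `|Re ν| < 1` (dominated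
convergence with `‖P_ρ(cosh u)‖ ≤ ‖ρ'‖₁/cosh u`). [folklore] -/
theorem tendsto_integral_exp_cosh_Pc (ν : ℂ) (hν : |ν.re| < 1) :
    Tendsto (fun ε : ℝ => ∫ u in Ioi (0 : ℝ), (Real.exp (-(ε * Real.cosh u)) : ℂ) * Complex.cosh (ν * u) * Pc ρ (Real.cosh u))
      (𝓝[>] 0) (𝓝 (∫ u in Ioi (0 : ℝ), Complex.cosh (ν * u) * Pc ρ (Real.cosh u))) := by
  have hPc := h.continuous_Pc_cosh
  refine tendsto_integral_filter_of_dominated_convergence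
    (fun u => Real.exp (|ν.re| * |u|) * ((∫ x, ‖deriv ρ x‖) / Real.cosh u)) ?_ ?_ (integrableOn_bound ν hν) ?_
  · refine Filter.Eventually.of_forall fun ε => ?_
    have : Continuous fun u : ℝ => (Real.exp (-(ε * Real.cosh u)) : ℂ) * Complex.cosh (ν * u) * Pc ρ (Real.cosh u) :=
      (by fun_prop : Continuous fun u : ℝ => (Real.exp (-(ε * Real.cosh u)) : ℂ) * Complex.cosh (ν * u)).mul hPc
    exact this.aestronglyMeasurable
  · filter_upwards [self_mem_nhdsWithin] with ε hε
    have hε : (0 : ℝ) < ε := hε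
    refine ae_of_all _ fun u => ?_
    rw [norm_mul, norm_mul, Complex.norm_real, Real.norm_eq_abs, abs_of_pos (Real.exp_pos _)]
    have h1 : Real.exp (-(ε * Real.cosh u)) ≤ 1 := by
      rw [Real.exp_le_one_iff]; have := Real.cosh_pos u; nlinarith
    have h2 := norm_cosh_mul_le ν u
    have h3 := h.norm_Pc_cosh_le u
    calc Real.exp (-(ε * Real.cosh u)) * ‖Complex.cosh (ν * u)‖ * ‖Pc ρ (Real.cosh u)‖
        ≤ 1 * Real.exp (|ν.re| * |u|) * ((∫ x, ‖deriv ρ x‖) / Real.cosh u) := by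
          gcongr
      _ = _ := by ring
  · refine ae_of_all _ fun u => ?_
    have hc : Continuous fun ε : ℝ => (Real.exp (-(ε * Real.cosh u)) : ℂ) * Complex.cosh (ν * u) * Pc ρ (Real.cosh u) := by
      fun_prop
    have := hc.tendsto 0
    simp only [zero_mul, neg_zero, Real.exp_zero, Complex.ofReal_one, one_mul] at this
    exact this.mono_left nhdsWithin_le_nhds

/-! ### The limit `ε → 0⁺` on the `x`-side -/

omit h in
/-- `I_μ` is bounded on the compact sets `{ε + σix : 0 ≤ ε ≤ 1, a ≤ x ≤ b}` (`σ = ±1`, `a > 0`), which lie in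
the slit plane. [folklore] -/
theorem exists_bound_besselIC (μ : ℂ) (σ : ℝ) (hσ : σ = 1 ∨ σ = -1) {a b : ℝ} (ha : 0 < a) :
    ∃ M : ℝ, ∀ ε ∈ Set.Icc (0 : ℝ) 1, ∀ x ∈ Set.Icc a b, ‖besselIC μ ((ε : ℂ) + σ * I * x)‖ ≤ M := by
  set f : ℝ × ℝ → ℂ := fun p => (p.1 : ℂ) + σ * I * p.2 with hf
  have hfc : Continuous f := by simp only [hf]; fun_prop
  set K : Set ℂ := f '' (Set.Icc (0 : ℝ) 1 ×ˢ Set.Icc a b) with hK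
  have hKc : IsCompact K := (isCompact_Icc.prod isCompact_Icc).image hfc
  have hKs : K ⊆ Complex.slitPlane := by
    rintro z ⟨⟨ε, x⟩, ⟨-, hx⟩, rfl⟩
    rw [Complex.mem_slitPlane_iff]
    right
    simp only [hf]
    have hx0 : x ≠ 0 := (ha.trans_le hx.1).ne'
    rcases hσ with h1 | h1 <;> simp [h1, hx0]
  obtain ⟨M, hM⟩ := hKc.exists_bound_of_continuousOn ((differentiableOn_besselIC μ).continuousOn.mono hKs)
  refine ⟨M, fun ε hε x hx => hM _ ⟨⟨ε, x⟩, ⟨hε, hx⟩, rfl⟩⟩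

omit h in
/-- Continuity of `ε ↦ I_μ(ε + w)` at `ε = 0` for `w` in the slit plane. [folklore] -/
theorem tendsto_besselIC_add (μ : ℂ) {w : ℂ} (hw : w ∈ Complex.slitPlane) :
    Tendsto (fun ε : ℝ => besselIC μ ((ε : ℂ) + w)) (𝓝[>] 0) (𝓝 (besselIC μ w)) := by
  have hc : ContinuousAt (besselIC μ) w :=
    ((differentiableOn_besselIC μ).differentiableAt (Complex.isOpen_slitPlane.mem_nhds hw)).continuousAt
  have h2 : Tendsto (fun ε : ℝ => (ε : ℂ) + w) (𝓝 0) (𝓝 w) := by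
    have hc2 : Continuous (fun ε : ℝ => (ε : ℂ) + w) := by fun_prop
    have := hc2.tendsto 0
    simpa using this
  exact (hc.tendsto.comp h2).mono_left nhdsWithin_le_nhds

omit h in
/-- `I_μ(ix) + I_μ(-ix) = 2 cos(πμ/2) J_μ(x)` (`x > 0`). [cite: Watson1944, §3.7 (2)] -/
theorem besselIC_I_mul_add (μ : ℂ) {x : ℝ} (hx : 0 < x) :
    besselIC μ (I * x) + besselIC μ (-I * x) = 2 * Complex.cos (π * μ / 2) * besselJC μ x := by
  rw [besselIC_I_mul μ hx, besselIC_neg_I_mul μ hx, Complex.cos, show π * μ / 2 * I = (π / 2) * I * μ by ring]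
  ring

/-- **The limit on the `x`-side**: as `ε → 0⁺`, for `sin(πν) ≠ 0`,
`∫ ρ(x)(K_ν(ε+ix) + K_ν(ε-ix)) dx → ∫ ρ(x) (π cos(πν/2)/sin(πν)) (J_{-ν}(x) - J_ν(x)) dx`, by (B.34) on
`Re z > 0`, the continuity of `I_{±ν}` at `±ix` and `I_μ(ix) + I_μ(-ix) = 2cos(πμ/2)J_μ(x)`. [folklore] -/
theorem tendsto_integral_mul_besselK_add (ν : ℂ) (hν : Complex.sin (π * ν) ≠ 0) :
    Tendsto (fun ε : ℝ => ∫ x : ℝ, ρ x * (besselK ν ((ε : ℂ) + I * x) + besselK ν ((ε : ℂ) + -I * x)))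
      (𝓝[>] 0) (𝓝 (∫ x : ℝ, ρ x * (π * Complex.cos (π * ν / 2) / Complex.sin (π * ν) * (besselJC (-ν) x - besselJC ν x)))) := by
  obtain ⟨M1, hM1⟩ := exists_bound_besselIC (-ν) 1 (Or.inl rfl) h.pos (b := b)
  obtain ⟨M2, hM2⟩ := exists_bound_besselIC ν 1 (Or.inl rfl) h.pos (b := b)
  obtain ⟨M3, hM3⟩ := exists_bound_besselIC (-ν) (-1) (Or.inr rfl) h.pos (b := b)
  obtain ⟨M4, hM4⟩ := exists_bound_besselIC ν (-1) (Or.inr rfl) h.pos (b := b)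
  set c : ℂ := π / 2 / Complex.sin (π * ν) with hc
  set B : ℝ := ‖c‖ * (M1 + M2) + ‖c‖ * (M3 + M4) with hB
  -- the formula for `K_ν(ε ± ix)`, `ε > 0`
  have hK : ∀ ε : ℝ, 0 < ε → ∀ x : ℝ, ∀ σ : ℂ, σ = I ∨ σ = -I →
      besselK ν ((ε : ℂ) + σ * x) = c * (besselIC (-ν) ((ε : ℂ) + σ * x) - besselIC ν ((ε : ℂ) + σ * x)) := by
    intro ε hε x σ hσ
    have hre : 0 < ((ε : ℂ) + σ * x).re := by
      rcases hσ with h1 | h1 <;> simp [h1, hε]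
    rw [besselK_eq_besselIC_of_re_pos hν hre, hc]
    ring
  refine tendsto_integral_filter_of_dominated_convergence (fun x => ‖ρ x‖ * B) ?_ ?_ (h.integrable.norm.mul_const B) ?_
  · -- measurability (continuity in `x` for `ε > 0`)
    filter_upwards [self_mem_nhdsWithin] with ε hε
    have hε : (0 : ℝ) < ε := hε
    have hKc : ∀ σ : ℂ, σ = I ∨ σ = -I → Continuous fun x : ℝ => besselK ν ((ε : ℂ) + σ * x) := by
      intro σ hσ
      have hmaps : ∀ x : ℝ, ((ε : ℂ) + σ * x) ∈ {z : ℂ | 0 < z.re} := by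
        intro x; rcases hσ with h1 | h1 <;> simp [h1, hε]
      exact (differentiableOn_besselK_right ν).continuousOn.comp_continuous (by fun_prop) hmaps
    have : Continuous fun x : ℝ => ρ x * (besselK ν ((ε : ℂ) + I * x) + besselK ν ((ε : ℂ) + -I * x)) :=
      h.smooth.continuous.mul ((hKc I (Or.inl rfl)).add (hKc (-I) (Or.inr rfl)))
    exact this.aestronglyMeasurable
  · -- domination for `0 < ε < 1`
    filter_upwards [Ioo_mem_nhdsGT one_pos] with ε hε
    refine ae_of_all _ fun x => ?_
    by_cases hx : ρ x = 0
    · simp [hx]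
    · have hxab : x ∈ Set.Icc a b := h.supp x hx
      have hεI : ε ∈ Set.Icc (0 : ℝ) 1 := ⟨hε.1.le, hε.2.le⟩
      rw [norm_mul]
      apply mul_le_mul_of_nonneg_left _ (norm_nonneg _)
      rw [hK ε hε.1 x I (Or.inl rfl), hK ε hε.1 x (-I) (Or.inr rfl)]
      have e1 : (ε : ℂ) + I * x = (ε : ℂ) + (1 : ℝ) * I * x := by push_cast; ring
      have e2 : (ε : ℂ) + -I * x = (ε : ℂ) + (-1 : ℝ) * I * x := by push_cast; ring
      have b1 := hM1 ε hεI x hxab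
      have b2 := hM2 ε hεI x hxab
      have b3 := hM3 ε hεI x hxab
      have b4 := hM4 ε hεI x hxab
      rw [← e1] at b1 b2
      rw [← e2] at b3 b4
      calc ‖c * (besselIC (-ν) ((ε : ℂ) + I * x) - besselIC ν ((ε : ℂ) + I * x)) +
              c * (besselIC (-ν) ((ε : ℂ) + -I * x) - besselIC ν ((ε : ℂ) + -I * x))‖
          ≤ ‖c * (besselIC (-ν) ((ε : ℂ) + I * x) - besselIC ν ((ε : ℂ) + I * x))‖ +
              ‖c * (besselIC (-ν) ((ε : ℂ) + -I * x) - besselIC ν ((ε : ℂ) + -I * x))‖ := norm_add_le _ _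
        _ ≤ ‖c‖ * (M1 + M2) + ‖c‖ * (M3 + M4) := by
            rw [norm_mul, norm_mul]
            gcongr
            · exact (norm_sub_le _ _).trans (add_le_add b1 b2)
            · exact (norm_sub_le _ _).trans (add_le_add b3 b4)
        _ = B := rfl
  · -- pointwise limit
    refine ae_of_all _ fun x => ?_
    by_cases hx : ρ x = 0
    · simp only [hx, zero_mul]
      exact tendsto_const_nhds
    · have hxab : x ∈ Set.Icc a b := h.supp x hx
      have hx0 : 0 < x := h.pos.trans_le hxab.1
      have hxI : I * (x : ℂ) ∈ Complex.slitPlane := by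
        rw [Complex.mem_slitPlane_iff]; right; simp [hx0.ne']
      have hxnI : -I * (x : ℂ) ∈ Complex.slitPlane := by
        rw [Complex.mem_slitPlane_iff]; right; simp [hx0.ne']
      have T1 := tendsto_besselIC_add (-ν) hxI
      have T2 := tendsto_besselIC_add ν hxI
      have T3 := tendsto_besselIC_add (-ν) hxnI
      have T4 := tendsto_besselIC_add ν hxnI
      have T := ((T1.sub T2).const_mul c).add ((T3.sub T4).const_mul c) |>.const_mul (ρ x)
      have hval : ρ x * (c * (besselIC (-ν) (I * x) - besselIC ν (I * x)) + c * (besselIC (-ν) (-I * x) - besselIC ν (-I * x))) =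
          ρ x * (π * Complex.cos (π * ν / 2) / Complex.sin (π * ν) * (besselJC (-ν) x - besselJC ν x)) := by
        have a1 := besselIC_I_mul_add (-ν) hx0
        have a2 := besselIC_I_mul_add ν hx0
        rw [show π * -ν / 2 = -(π * ν / 2) by ring, Complex.cos_neg] at a1
        rw [hc]
        linear_combination (ρ x * (π / 2 / Complex.sin (π * ν))) * (a1 - a2)
      rw [hval] at T
      refine T.congr' ?_
      filter_upwards [self_mem_nhdsWithin] with ε hε
      rw [hK ε hε x I (Or.inl rfl), hK ε hε x (-I) (Or.inr rfl)]

/-! ### The bridge -/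

/-- **Mehler–Sonine, integrated form** (`|Re ν| < 1`, `ν ∉ ℤ`): for a `C¹` function `ρ` supported in
`[a, b] ⊂ (0, ∞)`,
`2 ∫₀^∞ cosh(νu) P_ρ(cosh u) du = (π cos(πν/2)/sin(πν)) ∫ (J_{-ν}(x) - J_ν(x)) ρ(x) dx`
— the integrated form of `∫₀^∞ cos(x cosh u) cosh(νu) du = -(π/4)(J_ν(x) - J_{-ν}(x))/sin(νπ/2)`.
[cite: Watson1944, §6.21 (the Mehler–Sonine integrals); Iwaniec2002, Appendix B.5 (B.47) (`B_ν = (2 sin(πν/2))⁻¹(J_{-ν} - J_ν)`)] -/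
theorem two_mul_integral_cosh_mul_Pc_cosh (ν : ℂ) (hν : |ν.re| < 1) (hsin : Complex.sin (π * ν) ≠ 0) :
    2 * ∫ u in Ioi (0 : ℝ), Complex.cosh (ν * u) * Pc ρ (Real.cosh u) =
      ∫ x : ℝ, ρ x * (π * Complex.cos (π * ν / 2) / Complex.sin (π * ν) * (besselJC (-ν) x - besselJC ν x)) := by
  have L1 := (h.tendsto_integral_exp_cosh_Pc ν hν).const_mul (2 : ℂ)
  have L2 := h.tendsto_integral_mul_besselK_add ν hsin
  have L1' : Tendsto (fun ε : ℝ => ∫ x : ℝ, ρ x * (besselK ν ((ε : ℂ) + I * x) + besselK ν ((ε : ℂ) + -I * x)))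
      (𝓝[>] 0) (𝓝 (2 * ∫ u in Ioi (0 : ℝ), Complex.cosh (ν * u) * Pc ρ (Real.cosh u))) := by
    refine L1.congr' ?_
    filter_upwards [self_mem_nhdsWithin] with ε hε
    exact (h.integral_mul_besselK_add ν hε).symm
  exact tendsto_nhds_unique L1' L2

/-- `u ↦ cosh(νu) P_ρ(cosh u)` is integrable on `ℝ` for `|Re ν| < 1`. [folklore] -/
theorem integrable_cosh_mul_Pc_cosh (ν : ℂ) (hν : |ν.re| < 1) :
    Integrable fun u : ℝ => Complex.cosh (ν * u) * Pc ρ (Real.cosh u) := by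
  set C : ℝ := ∫ x, ‖deriv ρ x‖ with hC
  have hC0 : 0 ≤ C := integral_nonneg fun x => norm_nonneg _
  have hb : 0 < 1 - |ν.re| := by linarith
  refine (((integrable_exp_neg_mul_abs hb).const_mul (2 * C))).mono'
    ((by fun_prop : Continuous fun u : ℝ => Complex.cosh (ν * u)).mul h.continuous_Pc_cosh).aestronglyMeasurable
    (ae_of_all _ fun u => ?_)
  rw [norm_mul]
  have h1 := norm_cosh_mul_le ν u
  have h2 := h.norm_Pc_cosh_le u
  have h3 := exp_mul_div_cosh_le |ν.re| |u|
  rw [Real.cosh_abs] at h3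
  have hch := Real.cosh_pos u
  calc ‖Complex.cosh (ν * u)‖ * ‖Pc ρ (Real.cosh u)‖ ≤ Real.exp (|ν.re| * |u|) * (C / Real.cosh u) :=
        mul_le_mul h1 h2 (norm_nonneg _) (Real.exp_pos _).le
    _ = C * (Real.exp (|ν.re| * |u|) / Real.cosh u) := by ring
    _ ≤ C * (2 * Real.exp (-(1 - |ν.re|) * |u|)) := by gcongr
    _ = 2 * C * Real.exp (-(1 - |ν.re|) * |u|) := by ring

/-- The same over the whole line: `∫_ℝ cosh(νu) P_ρ(cosh u) du = (π cos(πν/2)/sin(πν)) ∫ (J_{-ν} - J_ν) ρ dx`.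
[cite: Watson1944, §6.21; Iwaniec2002, Appendix B.5 (B.47)] -/
theorem integral_cosh_mul_Pc_cosh (ν : ℂ) (hν : |ν.re| < 1) (hsin : Complex.sin (π * ν) ≠ 0) :
    ∫ u : ℝ, Complex.cosh (ν * u) * Pc ρ (Real.cosh u) =
      ∫ x : ℝ, ρ x * (π * Complex.cos (π * ν / 2) / Complex.sin (π * ν) * (besselJC (-ν) x - besselJC ν x)) := by
  rw [← h.two_mul_integral_cosh_mul_Pc_cosh ν hν hsin]
  set g : ℝ → ℂ := fun u => Complex.cosh (ν * u) * Pc ρ (Real.cosh u) with hg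
  have hint := h.integrable_cosh_mul_Pc_cosh ν hν
  have heven : ∀ u, g (-u) = g u := by
    intro u; simp only [hg, Real.cosh_neg]; push_cast; rw [mul_neg, Complex.cosh_neg]
  have hsplit := intervalIntegral.integral_Iic_add_Ioi hint.integrableOn (hint.integrableOn (s := Ioi 0)) (b := 0)
  have hleft : ∫ u in Iic (0 : ℝ), g u = ∫ u in Ioi (0 : ℝ), g u := by
    rw [← neg_zero, ← integral_comp_neg_Ioi 0 g, neg_zero]
    exact integral_congr_ae (ae_of_all _ fun u => heven u)
  change ∫ u, g u = 2 * ∫ u in Ioi (0 : ℝ), g u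
  rw [← hsplit, hleft]
  ring

end IsPosTest

end Literature.NumberTheory.Sieve.BFI.L1.Kuz


/-! ## The plus transforms of `kuzTransforms` are the `J`-Bessel transforms -/

namespace Literature.NumberTheory.Sieve.BFI.L1

open Kuz Literature.Analysis.FunctionSpaces MeasureTheory

/-- `H₊ φ ξ = P_{φ/x}(cosh ξ)`: the plus profile of `…KuznetsovTransforms` is the cosine transform `Pc` at `cosh ξ`. [folklore] -/
theorem Hp_eq_Pc {φ : ℝ → ℂ} (hφ : Continuous φ) (hc : HasCompactSupport φ) (hs : tsupport φ ⊆ Set.Ioi 0) (ξ : ℝ) :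
    Kuz.IsTest.Hp φ ξ = Kuz.Pc (fun x => φ x / (x : ℂ)) (Real.cosh ξ) := by
  rw [Kuz.IsTest.Hp, Pk_zero_eq_Pc hφ hc hs]

/-- **The plus profile against `cosh(νξ)`, general order** (`|Re ν| < 1`, `ν ∉ ℤ`): for `φ ∈ C¹` with compact
support in `(0, ∞)`,
`4 ∫_ℝ cosh(νξ) H₊φ(ξ) dξ = 4 (π cos(πν/2)/sin(πν)) ∫₀^∞ (J_{-ν}(x) - J_ν(x)) φ(x) dx/x`.
[cite: Watson1944, §6.21; Iwaniec2002, (B.47) & (9.13)] -/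
theorem four_mul_integral_cosh_mul_Hp {φ : ℝ → ℂ} (hφ : ContDiff ℝ 1 φ) (hc : HasCompactSupport φ)
    (hs : tsupport φ ⊆ Set.Ioi 0) (ν : ℂ) (hν : |ν.re| < 1) (hsin : Complex.sin (π * ν) ≠ 0) :
    4 * ∫ ξ : ℝ, Complex.cosh (ν * ξ) * Kuz.IsTest.Hp φ ξ =
      4 * (π * Complex.cos (π * ν / 2) / Complex.sin (π * ν)) *
        ∫ x in Set.Ioi (0 : ℝ), (besselJC (-ν) x - besselJC ν x) * (φ x / x) := by
  obtain ⟨a, b, ha, hab, hsupp⟩ := exists_Icc_of_admissible hc hs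
  have hρ := isPosTest_div ha hab hφ hsupp
  have h1 := hρ.integral_cosh_mul_Pc_cosh ν hν hsin
  have hset : ∫ x in Set.Ioi (0 : ℝ), (besselJC (-ν) x - besselJC ν x) * (φ x / x) =
      ∫ x : ℝ, (besselJC (-ν) x - besselJC ν x) * (φ x / x) := by
    apply setIntegral_eq_integral_of_forall_compl_eq_zero
    intro x hx
    have : φ x = 0 := by
      by_contra hne; exact hx (ha.trans_le (hsupp x hne).1)
    rw [this, zero_div, mul_zero]
  have h2 : (∫ ξ : ℝ, Complex.cosh (ν * ξ) * Kuz.IsTest.Hp φ ξ) =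
      ∫ ξ : ℝ, Complex.cosh (ν * ξ) * Kuz.Pc (fun x => φ x / (x : ℂ)) (Real.cosh ξ) := by
    refine integral_congr_ae (ae_of_all _ fun ξ => ?_)
    dsimp only
    rw [Hp_eq_Pc hφ.continuous hc hs]
  rw [hset, h2, h1, mul_assoc, ← integral_const_mul (π * Complex.cos (π * ν / 2) / Complex.sin (π * ν))]
  congr 1
  refine integral_congr_ae (ae_of_all _ fun x => ?_)
  dsimp only
  ring

/-- **`Tpl` is the `J`-Bessel transform of Kuznetsov's formula** (the Mehler–Sonine identity
`∫₀^∞ cos(x cosh ξ) cos(2tξ) dξ = (πi/(4 sinh πt))(J_{2it}(x) - J_{-2it}(x))` in integrated form): for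
`φ ∈ C¹` with compact support in `(0, ∞)` and real `t ≠ 0`,
`kuzTransforms.Tpl φ t = (2πi/sinh(πt)) ∫₀^∞ (J_{2it}(x) - J_{-2it}(x)) φ(x) dx/x`, with the complex-order
`besselJC` of `BesselJIComplexOrder.lean`. (At `t = 0` both `sinh(πt)` and `J_{2it} - J_{-2it}` vanish; the value
there is the `ν`-derivative, not needed for Kuznetsov's formula, where `t = 0` is a single point of the
`t`-integral and never a discrete spectral parameter.)
[cite: DeshouillersIwaniec1982, (1.17)–(1.19) & §7; Drappeau2017, (4.12); Iwaniec2002, (9.13)] -/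
theorem kuzTransforms_Tpl_eq_besselJ {φ : ℝ → ℂ} (hφ : ContDiff ℝ 1 φ) (hc : HasCompactSupport φ)
    (hs : tsupport φ ⊆ Set.Ioi 0) {t : ℝ} (ht : t ≠ 0) :
    kuzTransforms.Tpl φ t = 2 * π * I / (Real.sinh (π * t) : ℂ) *
      ∫ x in Set.Ioi (0 : ℝ), (besselJC (2 * t * I) x - besselJC (-(2 * t * I)) x) * (φ x / x) := by
  set ν : ℂ := 2 * t * I with hν
  have hνre : |ν.re| < 1 := by simp [hν]
  have hsh : Real.sinh (π * t) ≠ 0 := by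
    rw [Ne, Real.sinh_eq_zero]; exact mul_ne_zero Real.pi_ne_zero ht
  have hch : Real.cosh (π * t) ≠ 0 := (Real.cosh_pos _).ne'
  have hsinν : Complex.sin (π * ν) = (Real.sinh (2 * (π * t)) : ℂ) * I := by
    rw [hν, show (π : ℂ) * (2 * t * I) = ((2 * (π * t) : ℝ) : ℂ) * I by push_cast; ring, Complex.sin_mul_I,
      Complex.ofReal_sinh]
  have hcosν : Complex.cos (π * ν / 2) = (Real.cosh (π * t) : ℂ) := by
    rw [hν, show (π : ℂ) * (2 * t * I) / 2 = ((π * t : ℝ) : ℂ) * I by push_cast; ring, Complex.cos_mul_I,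
      Complex.ofReal_cosh]
  have hsin : Complex.sin (π * ν) ≠ 0 := by
    rw [hsinν]
    refine mul_ne_zero ?_ I_ne_zero
    rw [Real.sinh_two_mul]
    exact_mod_cast mul_ne_zero (mul_ne_zero two_ne_zero hsh) hch
  have key := four_mul_integral_cosh_mul_Hp hφ hc hs ν hνre hsin
  have hT : kuzTransforms.Tpl φ t = 4 * ∫ ξ : ℝ, Complex.cosh (ν * ξ) * Kuz.IsTest.Hp φ ξ := by
    show (4 * ∫ ξ : ℝ, (Real.cos (2 * t * ξ) : ℂ) * Kuz.IsTest.Hp φ ξ) = _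
    congr 1
    refine integral_congr_ae (ae_of_all _ fun ξ => ?_)
    dsimp only
    rw [hν, show 2 * (t : ℂ) * I * ξ = ((2 * t * ξ : ℝ) : ℂ) * I by push_cast; ring, Complex.cosh_mul_I,
      Complex.ofReal_cos]
  have hflip : ∫ x in Set.Ioi (0 : ℝ), (besselJC (-ν) x - besselJC ν x) * (φ x / x) =
      -∫ x in Set.Ioi (0 : ℝ), (besselJC ν x - besselJC (-ν) x) * (φ x / x) := by
    rw [← integral_neg]
    refine integral_congr_ae (ae_of_all _ fun x => ?_)
    dsimp only
    ring
  rw [hT, key, hflip, hsinν, hcosν, Real.sinh_two_mul]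
  have hshC : Complex.sinh ((π : ℂ) * t) ≠ 0 := by
    rw [← Complex.ofReal_mul, ← Complex.ofReal_sinh]; exact_mod_cast hsh
  have hchC : Complex.cosh ((π : ℂ) * t) ≠ 0 := by
    rw [← Complex.ofReal_mul, ← Complex.ofReal_cosh]; exact_mod_cast hch
  generalize (∫ x in Set.Ioi (0 : ℝ), (besselJC ν x - besselJC (-ν) x) * (φ x / x)) = J
  push_cast
  field_simp
  ring_nf
  rw [Complex.I_sq]
  ring

/-- **`TplX` is `φ̃(iy)`**: for `0 < |y| < 1/2`,
`kuzTransforms.TplX φ y = (2π/sin(πy)) ∫₀^∞ (J_{-2y}(x) - J_{2y}(x)) φ(x) dx/x`.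
[cite: DeshouillersIwaniec1982, (1.17) & (7.1); Drappeau2017, (4.12); Iwaniec2002, (9.13)] -/
theorem kuzTransforms_TplX_eq_besselJ {φ : ℝ → ℂ} (hφ : ContDiff ℝ 1 φ) (hc : HasCompactSupport φ)
    (hs : tsupport φ ⊆ Set.Ioi 0) {y : ℝ} (hy0 : y ≠ 0) (hy : |y| < 1 / 2) :
    kuzTransforms.TplX φ y = 2 * π / (Real.sin (π * y) : ℂ) *
      ∫ x in Set.Ioi (0 : ℝ), (besselJC (-((2 * y : ℝ) : ℂ)) x - besselJC ((2 * y : ℝ) : ℂ) x) * (φ x / x) := by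
  set ν : ℂ := ((2 * y : ℝ) : ℂ) with hν
  have hνre : |ν.re| < 1 := by
    simp only [hν, Complex.ofReal_re, abs_mul, abs_two]
    linarith
  have hyπ : |π * y| < π / 2 := by
    rw [abs_mul, abs_of_pos Real.pi_pos]
    nlinarith [Real.pi_pos]
  have hcos : Real.cos (π * y) ≠ 0 :=
    (Real.cos_pos_of_mem_Ioo ⟨by linarith [(abs_lt.1 hyπ).1], (abs_lt.1 hyπ).2⟩).ne'
  have hsinr : Real.sin (π * y) ≠ 0 := by
    rw [Ne, Real.sin_eq_zero_iff_of_lt_of_lt (by linarith [(abs_lt.1 hyπ).1, Real.pi_pos])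
      (by linarith [(abs_lt.1 hyπ).2, Real.pi_pos])]
    exact mul_ne_zero Real.pi_ne_zero hy0
  have hsinν : Complex.sin (π * ν) = (Real.sin (2 * (π * y)) : ℂ) := by
    rw [hν, show (π : ℂ) * ((2 * y : ℝ) : ℂ) = ((2 * (π * y) : ℝ) : ℂ) by push_cast; ring, Complex.ofReal_sin]
  have hcosν : Complex.cos (π * ν / 2) = (Real.cos (π * y) : ℂ) := by
    rw [hν, show (π : ℂ) * ((2 * y : ℝ) : ℂ) / 2 = ((π * y : ℝ) : ℂ) by push_cast; ring, Complex.ofReal_cos]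
  have hsin : Complex.sin (π * ν) ≠ 0 := by
    rw [hsinν, Real.sin_two_mul]
    exact_mod_cast mul_ne_zero (mul_ne_zero two_ne_zero hsinr) hcos
  have key := four_mul_integral_cosh_mul_Hp hφ hc hs ν hνre hsin
  have hT : kuzTransforms.TplX φ y = 4 * ∫ ξ : ℝ, Complex.cosh (ν * ξ) * Kuz.IsTest.Hp φ ξ := by
    show (4 * ∫ ξ : ℝ, (Real.cosh (2 * y * ξ) : ℂ) * Kuz.IsTest.Hp φ ξ) = _
    congr 1
    refine integral_congr_ae (ae_of_all _ fun ξ => ?_)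
    dsimp only
    rw [hν, Complex.ofReal_cosh]
    push_cast
    ring_nf
  rw [hT, key, hsinν, hcosν, Real.sin_two_mul]
  have hsC : Complex.sin ((π : ℂ) * y) ≠ 0 := by
    rw [← Complex.ofReal_mul, ← Complex.ofReal_sin]; exact_mod_cast hsinr
  have hcC : Complex.cos ((π : ℂ) * y) ≠ 0 := by
    rw [← Complex.ofReal_mul, ← Complex.ofReal_cos]; exact_mod_cast hcos
  generalize (∫ x in Set.Ioi (0 : ℝ), (besselJC (-ν) x - besselJC ν x) * (φ x / x)) = J
  push_cast
  field_simp
  ring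

/-- The admissible case (`KuzAdmissible φ`) of `kuzTransforms_Tpl_eq_besselJ`. [cite: Drappeau2017, (4.12)] -/
theorem kuzTransforms_Tpl_eq_besselJ_of_admissible {φ : ℝ → ℂ} (hφ : KuzAdmissible φ) {t : ℝ} (ht : t ≠ 0) :
    kuzTransforms.Tpl φ t = 2 * π * I / (Real.sinh (π * t) : ℂ) *
      ∫ x in Set.Ioi (0 : ℝ), (besselJC (2 * t * I) x - besselJC (-(2 * t * I)) x) * (φ x / x) :=
  kuzTransforms_Tpl_eq_besselJ (hφ.1.of_le (by exact_mod_cast le_top)) hφ.2.1 hφ.2.2 ht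

end Literature.NumberTheory.Sieve.BFI.L1
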